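import Mathlib
import Literature.Computability.MetaComplexity.SmolenskyParity

/-!
# The middle binomial coefficient is at most `2ⁿ/√n`

Helper for line Sketch/LAR of crux stmt-QuantumAdvantage-1392: for every `n ≥ 1`,
`C(n, ⌊n/2⌋) ≤ 2ⁿ / √n` (as real numbers). The integer core is `C(n, ⌊n/2⌋)² · n ≤ 4ⁿ` for all
`n`: for odd `n` this is `Smolensky.choose_half_sq_mul_le`, and for even `n = 2m` it follows from
`(2m+1) · C(2m, m)² ≤ 16^m` (`Smolensky.succ_mul_centralBinom_sq_le`). The real form is then
obtained by taking square roots.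
-/

namespace Summit.QuantumAdvantage.DigitPolyUniformity.SketchLAR

open Literature.Computability.MetaComplexity

namespace ChooseMiddleLe

/-- Even case of the integer core: `C(2m, m)² · (2m) ≤ 4^(2m)`, from
`(2m+1) · C(2m, m)² ≤ 16^m`. [folklore] -/
theorem choose_half_sq_mul_le_even (m : ℕ) :
    (2 * m).choose (2 * m / 2) ^ 2 * (2 * m) ≤ 4 ^ (2 * m) := by
  have hm : 2 * m / 2 = m := by omega
  rw [hm, ← Nat.centralBinom_eq_two_mul_choose]
  have h := Smolensky.succ_mul_centralBinom_sq_le m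
  calc Nat.centralBinom m ^ 2 * (2 * m)
      ≤ (2 * m + 1) * Nat.centralBinom m ^ 2 := by nlinarith [Nat.zero_le (Nat.centralBinom m ^ 2)]
    _ ≤ 16 ^ m := h
    _ = 4 ^ (2 * m) := by
        rw [pow_mul]
        norm_num

/-- The integer core for all `n`: `C(n, ⌊n/2⌋)² · n ≤ 4ⁿ`. [folklore] -/
theorem choose_half_sq_mul_le_all (n : ℕ) : n.choose (n / 2) ^ 2 * n ≤ 4 ^ n := by
  rcases Nat.even_or_odd n with h | h
  · obtain ⟨m, rfl⟩ := h
    have e : m + m = 2 * m := by ring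
    rw [e]
    exact choose_half_sq_mul_le_even m
  · exact Smolensky.choose_half_sq_mul_le h

end ChooseMiddleLe

/-- **The middle binomial coefficient is at most `2ⁿ/√n`**: for `n ≥ 1`,
`C(n, ⌊n/2⌋) ≤ 2ⁿ / √n`. (From `C(n, ⌊n/2⌋)² · n ≤ 4ⁿ = (2ⁿ)²` by taking square roots; the
hypothesis `n ≥ 1` is needed since for `n = 0` the right-hand side is `1/0 = 0`.) [folklore] -/
theorem stub_choose_middle_le (n : ℕ) (hn : 1 ≤ n) :
    (n.choose (n / 2) : ℝ) ≤ 2 ^ n / Real.sqrt n := by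
  have hnat : ((n.choose (n / 2) : ℕ) : ℝ) ^ 2 * n ≤ 4 ^ n := by
    exact_mod_cast ChooseMiddleLe.choose_half_sq_mul_le_all n
  have hnpos : (0 : ℝ) < n := Nat.cast_pos.2 hn
  rw [le_div_iff₀ (Real.sqrt_pos.2 hnpos)]
  have h4 : (4 : ℝ) ^ n = (2 ^ n) ^ 2 := by
    rw [← pow_mul, mul_comm, pow_mul]
    norm_num
  have key : ((n.choose (n / 2) : ℝ) * Real.sqrt n) ^ 2 ≤ (2 ^ n) ^ 2 := by
    rw [mul_pow, Real.sq_sqrt hnpos.le, ← h4]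
    exact hnat
  exact le_of_sq_le_sq key (by positivity)

end Summit.QuantumAdvantage.DigitPolyUniformity.SketchLAR
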